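import Literature.MathematicalPhysics.QuantumLattice.StrongExpDecayBoundaryInfluence
import Literature.MathematicalPhysics.QuantumLattice.CentreSymmetryDobrushin
import HarnessLib

/-!
# Boundary influence under exponential decay of correlations, II: Chatterjee's Lemma 7.3
# (non-local observables, by the Markov property) in two-volume form

S. Chatterjee, *A probabilistic mechanism for quark confinement*, CMP **385** (2021) [Chatterjee2021], §7,
**Lemma 7.3**: «Let `f : Ω_N° → [−1,1]` be a measurable function that depends only on `{ω_u : u ∈ E_N° ∖ E(e,r)}`.
Let `h : Ω_N → [−1,1]` be a local function supported on `e`. Then under any boundary condition on `B_N`,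
`|⟨fh⟩ − ⟨f⟩⟨h⟩| ≤ C₁ r^{d−1} e^{−C₂ r}`», proved by conditioning on the links outside the `r`-neighbourhood
cube `B = B(e,r)` («a lattice gauge theory is a Markov random field», the conditional law is the cube theory
with the induced boundary condition), Lemma 7.1 in the cube `B` (the conditional expectation of `h` depends on
the far part of the induced boundary condition only up to `C₁ r^{d−1} e^{−C₂ r}`) and Lemma 7.2 (the near part is
genuine boundary of `B_N`, hence frozen).

This file proves the lemma in **two-volume form** over the tree's Wilson kernels, with the geometry of
Lemma 7.2 supplied as hypotheses: an arbitrary finite OUTER volume `Λ` with exterior `η` (not necessarily a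
cube — e.g. a column of Chatterjee's slab `S_{M,N}`), an INNER cube `v' + {0,…,M'}^d` with interior link set
`Λ' ⊆ Λ`, an edge `e` of the inner cube, and a finite set `D` of «far» boundary links of the inner cube
(`D ∩ Λ' = ∅`, `D` outside the plaquette-neighbourhood of `e`) such that every link outside `Λ'` read by the
inner kernel or by `h` lies in `D` or outside `Λ`. Then (`abs_cov_le_of_strongExpDecayZd_twoVolume`)
`|⟨fh⟩_{Λ,η} − ⟨f⟩_{Λ,η}⟨h⟩_{Λ,η}| ≤ 2 Σ_{u ∈ D} e^{2c_u} K₁ e^{−K₂ dist(e,u)}`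
for every measurable `f` with `|f| ≤ 1` not reading `Λ'` and every measurable `h` with `|h| ≤ 1` supported on the
plaquette-neighbourhood of `e`. Ingredients: consistency of the Wilson specification in integral form
(`integral_mul_eq_integral_mul_kernel`, the Markov property), locality of the kernels
(`integral_ymSpecification_congr_of_eqOn`), and Lemma 7.5 of the companion file
(`abs_integral_sub_le_of_strongExpDecayZd_of_eqOn`, derivative-free). Valid for every compact gauge group.

(v2, appended) **Corollary 7.4, first claim** (`abs_integral_update_sub_le_of_strongExpDecayZd_twoVolume`:
one far boundary link changed, NON-LOCAL `f`: change-of-boundary-condition identity + Lemma 7.3 for the pair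
`(f, Ẽ_a)`) and **Lemma 7.5 for non-local `f`** (`abs_integral_sub_le_of_strongExpDecayZd_twoVolume_of_eqOn`:
inner-cube data per changed link, telescoping) — the form behind Cor. 7.6.

Not here: the construction of `B(e,r)` and the count `#D ≤ C r^{d−1}` (Lemma 7.2), i.e. the instantiation
`C₁ r^{d−1} e^{−C₂ r}`; the coupling constructions §§8–11.

## References
* S. Chatterjee, CMP 385 (2021), arXiv:2006.16229: §7 Lemmas 7.1–7.3, Cor. 7.6.
* H.-O. Georgii, *Gibbs Measures and Phase Transitions* (2011), Def. 1.23 (consistency).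
-/

noncomputable section

open MeasureTheory Filter Function
open scoped Topology

namespace Literature.MathematicalPhysics.QuantumLattice

open Literature.Probability.LatticeModels

section Wilson

variable {d N : ℕ} {G : Type*} [Group G] [TopologicalSpace G] [IsTopologicalGroup G]
  [CompactSpace G] [MeasurableSpace G] [BorelSpace G] [SecondCountableTopology G]
  (ρ : G →* Matrix (Fin N) (Fin N) ℂ)

/-- **Locality of the Wilson kernels in the boundary condition**: `∫ h dγ_Λ(·|σ₁) = ∫ h dγ_Λ(·|σ₂)` whenever
`σ₁, σ₂` agree on every exterior link read by the Boltzmann weight (the links of plaquettes touching `Λ`) or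
by the cylinder observable `h` (Seiler LNP 159 Ch. 2: finite range of the Wilson specification; Chatterjee
2021 §7: «the conditional law … is again a lattice gauge theory on the cube `B`, with boundary condition
`δ'`»). [cite: Chatterjee2021, §7 proof of Lemma 7.3] -/
theorem integral_ymSpecification_congr_of_eqOn (hρ : Continuous ρ) (β : ℝ) (Λ : Finset (ZdEdge d))
    {S : Finset (ZdEdge d)} {h : LGConfig d G → ℝ} (hhm : Measurable h) (hh : IsCylinder h S)
    {σ₁ σ₂ : LGConfig d G}
    (hσ : ∀ e, e ∉ Λ → (e ∈ (plaquettesTouching Λ).biUnion plaquetteEdges ∨ e ∈ S) → σ₁ e = σ₂ e) :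
    ∫ U, h U ∂(ymSpecification ρ β Λ σ₁) = ∫ U, h U ∂(ymSpecification ρ β Λ σ₂) := by
  classical
  set π : Measure (↥Λ → G) := Measure.pi fun _ : ↥Λ => QuantumFieldTheory.haarProbability G with hπ
  set Φ : LGConfig d G → ℝ := fun U => -β * wilsonBoundaryAction ρ Λ U with hΦ
  have hΦm : Measurable Φ := (continuous_const.mul (continuous_wilsonBoundaryAction ρ hρ Λ)).measurable
  -- glued configurations agree where it matters
  have hagree : ∀ (u : ↥Λ → G) (e : ZdEdge d),
      (e ∈ (plaquettesTouching Λ).biUnion plaquetteEdges ∨ e ∈ S) → glueWith Λ u σ₁ e = glueWith Λ u σ₂ e := by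
    intro u e he
    by_cases heΛ : e ∈ Λ
    · rw [glueWith_apply_mem _ _ _ heΛ, glueWith_apply_mem _ _ _ heΛ]
    · rw [glueWith_apply_not_mem _ _ _ heΛ, glueWith_apply_not_mem _ _ _ heΛ]
      exact hσ e heΛ he
  have hΦeq : (Φ ∘ fun u : ↥Λ → G => glueWith Λ u σ₁) = (Φ ∘ fun u : ↥Λ → G => glueWith Λ u σ₂) := by
    funext u
    simp only [Function.comp_apply, hΦ]
    rw [isCylinder_wilsonBoundaryAction_holds ρ Λ fun e he => hagree u e (Or.inl (Finset.mem_coe.1 he))]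
  have hheq : ∀ u : ↥Λ → G, h (glueWith Λ u σ₁) = h (glueWith Λ u σ₂) := fun u =>
    hh fun e he => hagree u e (Or.inr (Finset.mem_coe.1 he))
  have h1 : ∫ U, h U ∂(ymSpecification ρ β Λ σ₁) =
      ∫ u, h (glueWith Λ u σ₁) ∂(π.tilted (Φ ∘ fun u => glueWith Λ u σ₁)) :=
    integral_tilted_map_eq_integral_tilted_comp π (measurable_glueWith Λ _) hΦm hhm
  have h2 : ∫ U, h U ∂(ymSpecification ρ β Λ σ₂) =
      ∫ u, h (glueWith Λ u σ₂) ∂(π.tilted (Φ ∘ fun u => glueWith Λ u σ₂)) :=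
    integral_tilted_map_eq_integral_tilted_comp π (measurable_glueWith Λ _) hΦm hhm
  rw [h1, h2, hΦeq]
  exact integral_congr_ae (ae_of_all _ hheq)

variable [T2Space G]

/-- **The Markov property in integral form** (consistency of the Wilson specification, Georgii Def. 1.23
(iii), with the outer observable pulled out by properness): for `Λ' ⊆ Λ`, a bounded measurable `f` not reading
the links of `Λ'` and a bounded measurable `h`,
`∫ f h dγ_Λ(·|η) = ∫ f(σ) (∫ h dγ_{Λ'}(·|σ)) dγ_Λ(·|η)(σ)` — «conditioning on the links outside the inner
volume, the theory inside is the inner kernel with the induced boundary condition» (Chatterjee 2021, proof of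
Lemma 7.3). [cite: Chatterjee2021, §7 proof of Lemma 7.3] -/
theorem integral_mul_eq_integral_mul_kernel (hρ : Continuous ρ) (β : ℝ) {Λ Λ' : Finset (ZdEdge d)}
    (hsub : Λ' ⊆ Λ) (η : LGConfig d G) {f h : LGConfig d G → ℝ} (hfm : Measurable f)
    (hfb : ∃ B, ∀ U, |f U| ≤ B) (hf : DependsOn f ((↑Λ' : Set (ZdEdge d))ᶜ)) (hhm : Measurable h)
    (hhb : ∃ B, ∀ U, |h U| ≤ B) :
    ∫ U, f U * h U ∂(ymSpecification ρ β Λ η) =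
      ∫ σ, f σ * (∫ U, h U ∂(ymSpecification ρ β Λ' σ)) ∂(ymSpecification ρ β Λ η) := by
  have hγ := QuantumFieldTheory.isSpecification_ymSpecification_of_t2Space (d := d) ρ hρ β
  haveI := hγ.isProbability Λ η
  obtain ⟨Bf, hBf⟩ := hfb
  obtain ⟨Bh, hBh⟩ := hhb
  have hfhi : Integrable (fun U => f U * h U) (ymSpecification ρ β Λ η) := by
    refine Integrable.of_bound (hfm.mul hhm).aestronglyMeasurable (Bf * Bh) (ae_of_all _ fun U => ?_)
    rw [Real.norm_eq_abs, abs_mul]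
    exact mul_le_mul (hBf U) (hBh U) (abs_nonneg _) ((abs_nonneg _).trans (hBf U))
  rw [← DobrushinFrozen.integral_integral_eq_of_dlr hγ Λ' (hγ.consistent hsub η) hfhi]
  refine integral_congr_ae (ae_of_all _ fun σ => ?_)
  -- properness: under `γ_{Λ'}(·|σ)`, `f = f σ` a.e.
  haveI := hγ.isProbability Λ' σ
  have hae : ∀ᵐ U ∂(ymSpecification ρ β Λ' σ), f U * h U = f σ * h U := by
    filter_upwards [hγ.proper Λ' σ] with U hU
    rw [hf fun e he => hU e fun heΛ => he (Finset.mem_coe.2 heΛ)]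
  show ∫ U, f U * h U ∂(ymSpecification ρ β Λ' σ) = f σ * ∫ U, h U ∂(ymSpecification ρ β Λ' σ)
  rw [integral_congr_ae hae, integral_const_mul]

/-- ★ **Chatterjee 2021, Lemma 7.3 in two-volume form** (covariance of a non-local observable with a local one,
by the Markov property). Exponential decay of correlations with constants `K₁, K₂` (Def. 2.3),
`|Re tr ρ(U_p)| ≤ C`; an arbitrary finite outer volume `Λ` with exterior `η`; an inner cube `v' + {0,…,M'}^d` with
interior link set `Λ' ⊆ Λ`; an edge `e` of the inner cube; a finite set `D` of links of the inner cube, each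
outside `Λ'` and outside the plaquette-neighbourhood of `e` (the «far» boundary links), such that every link
outside `Λ'` read by the inner kernel (links of plaquettes touching `Λ'`) or by `h` lies in `D` or outside `Λ`
(the «near» boundary links of the inner cube are exterior to `Λ`, Chatterjee's Lemma 7.2). Then for every
measurable `f` with `|f| ≤ 1` not reading `Λ'` and every measurable `h` with `|h| ≤ 1` supported on the
plaquette-neighbourhood of `e`:
`|∫ fh dγ_Λ(·|η) − (∫ f dγ_Λ(·|η))(∫ h dγ_Λ(·|η))| ≤ 2 Σ_{u ∈ D} e^{2c_u} K₁ e^{−K₂ dist(e,u)}`,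
`c_u = |β|·2C·#{plaquettes ∋ u}`. [cite: Chatterjee2021, Lemma 7.3] -/
theorem abs_cov_le_of_strongExpDecayZd_twoVolume (hρ : Continuous ρ) {C : ℝ} (hC0 : 0 ≤ C)
    (hC : ∀ (x : Site d) (i j : Fin d) (U : LGConfig d G), |plaquetteObs ρ x i j U| ≤ C)
    {β K₁ K₂ : ℝ} (hdecay : StrongExpDecayZd d ρ β K₁ K₂) (Λ : Finset (ZdEdge d)) (η : LGConfig d G)
    (M' : ℕ) (v' : Fin d → ℤ) (Λ' : Finset (ZdEdge d))
    (hΛ' : Λ' = (((Fintype.piFinset fun j : Fin d => Finset.Icc (v' j) (v' j + M')) ×ˢ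
        (Finset.univ : Finset (Fin d))).filter fun e =>
          e.1 e.2 + 1 ≤ v' e.2 + M' ∧ ∀ j, j ≠ e.2 → v' j < e.1 j ∧ e.1 j < v' j + M'))
    (hsub : Λ' ⊆ Λ) (e : ZdEdge d) (he : ∀ j, v' j ≤ e.1 j ∧ e.1 j ≤ v' j + M')
    (he' : e.1 e.2 + 1 ≤ v' e.2 + M') (D : Finset (ZdEdge d))
    (hD : ∀ u ∈ D, (∀ j, v' j ≤ u.1 j ∧ u.1 j ≤ v' j + M') ∧ u.1 u.2 + 1 ≤ v' u.2 + M' ∧ u ∉ Λ' ∧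
      u ∉ (plaquettesTouching ({e} : Finset (ZdEdge d))).biUnion plaquetteEdges)
    (hread : ∀ u, u ∉ Λ' → (u ∈ (plaquettesTouching Λ').biUnion plaquetteEdges ∨
      u ∈ (plaquettesTouching ({e} : Finset (ZdEdge d))).biUnion plaquetteEdges) → u ∈ D ∨ u ∉ Λ)
    {f h : LGConfig d G → ℝ} (hfm : Measurable f) (hf1 : ∀ U, |f U| ≤ 1)
    (hfdep : DependsOn f ((↑Λ' : Set (ZdEdge d))ᶜ)) (hhm : Measurable h)
    (hhcyl : IsCylinder h ((plaquettesTouching ({e} : Finset (ZdEdge d))).biUnion plaquetteEdges))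
    (hh1 : ∀ U, |h U| ≤ 1) :
    |(∫ U, f U * h U ∂(ymSpecification ρ β Λ η)) -
        (∫ U, f U ∂(ymSpecification ρ β Λ η)) * ∫ U, h U ∂(ymSpecification ρ β Λ η)| ≤
      2 * ∑ u ∈ D, Real.exp (2 * (|β| * (2 * C * (plaquettesTouching ({u} : Finset (ZdEdge d))).card))) *
        (K₁ * Real.exp (-(K₂ * QuantumFieldTheory.setDistEdges {e} {u}))) := by
  classical
  have hγ := QuantumFieldTheory.isSpecification_ymSpecification_of_t2Space (d := d) ρ hρ β
  set μ := ymSpecification ρ β Λ η with hμ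
  haveI : IsProbabilityMeasure μ := hγ.isProbability Λ η
  set ε : ℝ := ∑ u ∈ D, Real.exp (2 * (|β| * (2 * C * (plaquettesTouching ({u} : Finset (ZdEdge d))).card))) *
    (K₁ * Real.exp (-(K₂ * QuantumFieldTheory.setDistEdges {e} {u}))) with hε
  -- the conditional expectation of `h` given the links outside `Λ'`
  set H : LGConfig d G → ℝ := fun σ => ∫ U, h U ∂(ymSpecification ρ β Λ' σ) with hH
  have hHm : Measurable H := by
    let κ : ProbabilityTheory.Kernel (LGConfig d G) (LGConfig d G) :=
      ⟨ymSpecification ρ β Λ', hγ.measurable_fun Λ'⟩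
    exact (hhm.stronglyMeasurable.integral_kernel (κ := κ)).measurable
  have hH1 : ∀ σ, |H σ| ≤ 1 := fun σ => by
    haveI := hγ.isProbability Λ' σ
    have h1 := norm_integral_le_of_norm_le_const (μ := ymSpecification ρ β Λ' σ) (f := h) (C := 1)
      (ae_of_all _ fun U => by rw [Real.norm_eq_abs]; exact hh1 U)
    simpa [hH] using h1
  -- (1) Markov property
  have hfh : ∫ U, f U * h U ∂μ = ∫ σ, f σ * H σ ∂μ :=
    integral_mul_eq_integral_mul_kernel ρ hρ β hsub η hfm ⟨1, hf1⟩ hfdep hhm ⟨1, hh1⟩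
  have hh' : ∫ U, h U ∂μ = ∫ σ, H σ ∂μ :=
    (DobrushinFrozen.integral_integral_eq_of_dlr hγ Λ' (hγ.consistent hsub η)
      (DobrushinMetric.integrable_of_abs_le' hhm hh1)).symm
  -- (2) `H` is almost constant under `μ`: `|H σ − H η| ≤ ε` for `σ = η` off `Λ`
  have hHc : ∀ σ : LGConfig d G, (∀ x ∉ Λ, σ x = η x) → |H σ - H η| ≤ ε := by
    intro σ hσ
    -- replace `σ` by `η` on the far links `D`
    set τ : LGConfig d G := D.piecewise η σ with hτ
    have h75 := abs_integral_sub_le_of_strongExpDecayZd_of_eqOn ρ hρ hC0 hC hdecay M' v' Λ' hΛ' e he he' D hD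
      τ σ (fun x hx => by rw [hτ, Finset.piecewise_eq_of_notMem _ _ _ hx]) hhm hhcyl hh1
    -- `H τ = H η` by locality of the inner kernel
    have hloc : H τ = H η := by
      refine integral_ymSpecification_congr_of_eqOn ρ hρ β Λ' hhm hhcyl fun u huΛ' hu => ?_
      rcases hread u huΛ' hu with huD | huΛ
      · rw [hτ, Finset.piecewise_eq_of_mem _ _ _ huD]
      · by_cases huD : u ∈ D
        · rw [hτ, Finset.piecewise_eq_of_mem _ _ _ huD]
        · rw [hτ, Finset.piecewise_eq_of_notMem _ _ _ huD, hσ u huΛ]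
    rw [← hloc]
    simpa [hH] using h75
  have hε0 : 0 ≤ ε := (abs_nonneg _).trans (hHc η fun _ _ => rfl)
  -- (3) covariance with an almost-constant function
  have hfi : Integrable f μ := DobrushinMetric.integrable_of_abs_le' hfm hf1
  have hHi : Integrable H μ := DobrushinMetric.integrable_of_abs_le' hHm hH1
  have hfHi : Integrable (fun σ => f σ * (H σ - H η)) μ := by
    refine Integrable.of_bound (hfm.mul (hHm.sub measurable_const)).aestronglyMeasurable (1 * 2)
      (ae_of_all _ fun σ => ?_)
    rw [Real.norm_eq_abs, abs_mul]
    refine mul_le_mul (hf1 σ) ?_ (abs_nonneg _) zero_le_one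
    calc |H σ - H η| ≤ |H σ| + |H η| := abs_sub _ _
      _ ≤ 1 + 1 := add_le_add (hH1 σ) (hH1 η)
      _ = 2 := by norm_num
  have hcov : (∫ U, f U * h U ∂μ) - (∫ U, f U ∂μ) * ∫ U, h U ∂μ =
      (∫ σ, f σ * (H σ - H η) ∂μ) - (∫ σ, f σ ∂μ) * ∫ σ, (H σ - H η) ∂μ := by
    rw [hfh, hh', integral_sub hHi (integrable_const _), integral_const]
    have : ∫ σ, f σ * (H σ - H η) ∂μ = (∫ σ, f σ * H σ ∂μ) - (∫ σ, f σ ∂μ) * H η := by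
      have hsplit : (fun σ => f σ * (H σ - H η)) = fun σ => f σ * H σ - f σ * H η := by
        funext σ; ring
      rw [hsplit, integral_sub (by
          refine Integrable.of_bound (hfm.mul hHm).aestronglyMeasurable (1 * 1) (ae_of_all _ fun σ => ?_)
          rw [Real.norm_eq_abs, abs_mul]
          exact mul_le_mul (hf1 σ) (hH1 σ) (abs_nonneg _) zero_le_one) (hfi.mul_const _),
        integral_mul_const]
    rw [this]
    simp
    ring
  -- (4) the two a.e. bounds
  have hb1 : |∫ σ, f σ * (H σ - H η) ∂μ| ≤ ε := by
    have h1 := norm_integral_le_of_norm_le_const (μ := μ) (f := fun σ => f σ * (H σ - H η)) (C := ε) ?_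
    · simpa using h1
    filter_upwards [hγ.proper Λ η] with σ hσ
    rw [Real.norm_eq_abs, abs_mul]
    calc |f σ| * |H σ - H η| ≤ 1 * ε := mul_le_mul (hf1 σ) (hHc σ hσ) (abs_nonneg _) zero_le_one
      _ = ε := one_mul ε
  have hb2 : |∫ σ, (H σ - H η) ∂μ| ≤ ε := by
    have h1 := norm_integral_le_of_norm_le_const (μ := μ) (f := fun σ => H σ - H η) (C := ε) ?_
    · simpa using h1
    filter_upwards [hγ.proper Λ η] with σ hσ
    rw [Real.norm_eq_abs]
    exact hHc σ hσ
  have hb3 : |∫ σ, f σ ∂μ| ≤ 1 := by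
    have h1 := norm_integral_le_of_norm_le_const (μ := μ) (f := f) (C := 1)
      (ae_of_all _ fun σ => by rw [Real.norm_eq_abs]; exact hf1 σ)
    simpa using h1
  rw [hcov]
  calc |(∫ σ, f σ * (H σ - H η) ∂μ) - (∫ σ, f σ ∂μ) * ∫ σ, (H σ - H η) ∂μ|
      ≤ |∫ σ, f σ * (H σ - H η) ∂μ| + |(∫ σ, f σ ∂μ) * ∫ σ, (H σ - H η) ∂μ| := abs_sub _ _
    _ = |∫ σ, f σ * (H σ - H η) ∂μ| + |∫ σ, f σ ∂μ| * |∫ σ, (H σ - H η) ∂μ| := by rw [abs_mul]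
    _ ≤ ε + 1 * ε := add_le_add hb1 (mul_le_mul hb3 hb2 (abs_nonneg _) zero_le_one)
    _ = 2 * ε := by ring


/-! ### Corollary 7.4 (first claim) and Lemma 7.5 for non-local observables, two-volume form -/

/-- ★ **Chatterjee 2021, Corollary 7.4, first claim, two-volume form** («`‖∇_e⟨f⟩‖ ≤ C₁ r^{d−1} e^{−C₂ r}`;
consequently, if `δ_e` is replaced by any other value, `⟨f⟩` changes by at most `C₁ r^{d−1} e^{−C₂ r}`», for `f`
depending only on links outside the `r`-neighbourhood of `e`), derivative-free: with the data of
`abs_cov_le_of_strongExpDecayZd_twoVolume` around the changed link `a` (an edge of the inner cube, exterior to the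
outer volume `Λ`), for every measurable `f` with `|f| ≤ 1` not reading `Λ'` nor the link `a`:
`|∫ f dγ_Λ(·|η^{a←b}) − ∫ f dγ_Λ(·|η)| ≤ e^{2c_a} · 2 Σ_{u ∈ D} e^{2c_u} K₁ e^{−K₂ dist(a,u)}` — the
change-of-boundary-condition identity (`abs_integral_ymSpecification_update_sub_le`) followed by Lemma 7.3 for the
pair `(f, Ẽ_a)`. [cite: Chatterjee2021, Cor. 7.4] -/
theorem abs_integral_update_sub_le_of_strongExpDecayZd_twoVolume (hρ : Continuous ρ) {C : ℝ} (hC0 : 0 ≤ C)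
    (hC : ∀ (x : Site d) (i j : Fin d) (U : LGConfig d G), |plaquetteObs ρ x i j U| ≤ C)
    {β K₁ K₂ : ℝ} (hdecay : StrongExpDecayZd d ρ β K₁ K₂) (Λ : Finset (ZdEdge d)) (η : LGConfig d G)
    (M' : ℕ) (v' : Fin d → ℤ) (Λ' : Finset (ZdEdge d))
    (hΛ' : Λ' = (((Fintype.piFinset fun j : Fin d => Finset.Icc (v' j) (v' j + M')) ×ˢ
        (Finset.univ : Finset (Fin d))).filter fun e =>
          e.1 e.2 + 1 ≤ v' e.2 + M' ∧ ∀ j, j ≠ e.2 → v' j < e.1 j ∧ e.1 j < v' j + M'))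
    (hsub : Λ' ⊆ Λ) (a : ZdEdge d) (ha : ∀ j, v' j ≤ a.1 j ∧ a.1 j ≤ v' j + M')
    (ha' : a.1 a.2 + 1 ≤ v' a.2 + M') (haΛ : a ∉ Λ) (D : Finset (ZdEdge d))
    (hD : ∀ u ∈ D, (∀ j, v' j ≤ u.1 j ∧ u.1 j ≤ v' j + M') ∧ u.1 u.2 + 1 ≤ v' u.2 + M' ∧ u ∉ Λ' ∧
      u ∉ (plaquettesTouching ({a} : Finset (ZdEdge d))).biUnion plaquetteEdges)
    (hread : ∀ u, u ∉ Λ' → (u ∈ (plaquettesTouching Λ').biUnion plaquetteEdges ∨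
      u ∈ (plaquettesTouching ({a} : Finset (ZdEdge d))).biUnion plaquetteEdges) → u ∈ D ∨ u ∉ Λ)
    (b : G) {f : LGConfig d G → ℝ} (hfm : Measurable f) (hf1 : ∀ U, |f U| ≤ 1)
    (hfdep : DependsOn f ((↑Λ' : Set (ZdEdge d))ᶜ)) (hfa : ∀ U, f (Function.update U a b) = f U) :
    |(∫ U, f U ∂(ymSpecification ρ β Λ (Function.update η a b))) - ∫ U, f U ∂(ymSpecification ρ β Λ η)| ≤
      Real.exp (2 * (|β| * (2 * C * (plaquettesTouching ({a} : Finset (ZdEdge d))).card))) *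
        (2 * ∑ u ∈ D, Real.exp (2 * (|β| * (2 * C * (plaquettesTouching ({u} : Finset (ZdEdge d))).card))) *
          (K₁ * Real.exp (-(K₂ * QuantumFieldTheory.setDistEdges {a} {u})))) := by
  set c : ℝ := |β| * (2 * C * (plaquettesTouching ({a} : Finset (ZdEdge d))).card) with hc
  have h1 := abs_integral_ymSpecification_update_sub_le ρ hρ hC0 hC β Λ η haΛ b hfm hf1 hfa
  refine h1.trans (mul_le_mul_of_nonneg_left ?_ (Real.exp_pos _).le)
  -- the normalised Boltzmann ratio `Ẽ_a`: measurable, local at `a`, `|Ẽ_a| ≤ 1`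
  set g : LGConfig d G → ℝ := fun U => Real.exp (-c) *
    Real.exp (-β * (wilsonBoundaryAction ρ Λ (Function.update U a b) - wilsonBoundaryAction ρ Λ U)) with hg
  have hgc : Continuous g := continuous_const.mul (Real.continuous_exp.comp (continuous_const.mul
    (((continuous_wilsonBoundaryAction ρ hρ Λ).comp (continuous_id.update a continuous_const)).sub
      (continuous_wilsonBoundaryAction ρ hρ Λ))))
  have hgm : Measurable g := hgc.measurable
  have hgcyl : IsCylinder g ((plaquettesTouching ({a} : Finset (ZdEdge d))).biUnion plaquetteEdges) :=
    isCylinder_boltzmannRatio ρ β Λ a b (Real.exp (-c))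
  have hexp : ∀ U : LGConfig d G,
      |-β * (wilsonBoundaryAction ρ Λ (Function.update U a b) - wilsonBoundaryAction ρ Λ U)| ≤ c := fun U => by
    rw [abs_mul, abs_neg, hc]
    refine mul_le_mul_of_nonneg_left ?_ (abs_nonneg β)
    exact abs_wilsonBoundaryAction_sub_le ρ hC0 hC Λ {a} (U := Function.update U a b) (U' := U)
      fun e he => Function.update_of_ne (by simpa using he) _ _
  have hg1 : ∀ U, |g U| ≤ 1 := fun U => by
    have hpos : 0 < Real.exp (-β * (wilsonBoundaryAction ρ Λ (Function.update U a b) -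
        wilsonBoundaryAction ρ Λ U)) := Real.exp_pos _
    have hhi : Real.exp (-β * (wilsonBoundaryAction ρ Λ (Function.update U a b) -
        wilsonBoundaryAction ρ Λ U)) ≤ Real.exp c := Real.exp_le_exp.2 (abs_le.1 (hexp U)).2
    rw [hg, abs_of_pos (mul_pos (Real.exp_pos _) hpos)]
    calc Real.exp (-c) * Real.exp (-β * (wilsonBoundaryAction ρ Λ (Function.update U a b) -
          wilsonBoundaryAction ρ Λ U)) ≤ Real.exp (-c) * Real.exp c :=
          mul_le_mul_of_nonneg_left hhi (Real.exp_pos _).le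
      _ = 1 := by rw [← Real.exp_add]; simp
  exact abs_cov_le_of_strongExpDecayZd_twoVolume ρ hρ hC0 hC hdecay Λ η M' v' Λ' hΛ' hsub a ha ha' D hD hread
    hfm hf1 hfdep hgm hgcyl hg1

/-- ★ **Chatterjee 2021, Lemma 7.5 for non-local observables, two-volume form** («for any two boundary conditions
`δ, δ'` that agree on the complement of `A`, the values of `⟨f⟩` differ by at most `C₁ |A| r^{d−1} e^{−C₂ r}`» for
`f` depending only on links outside `E(A,r)`; with Cor. 7.6 = its total-variation restatement): if for every
`a ∈ A` inner-cube data `(M'_a, v'_a, Λ'_a, D_a)` as in `abs_integral_update_sub_le_of_strongExpDecayZd_twoVolume` are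
given and `f` reads no link of `⋃_a Λ'_a ∪ A`, then for `η, η'` agreeing off `A`,
`|∫ f dγ_Λ(·|η') − ∫ f dγ_Λ(·|η)| ≤ Σ_{a ∈ A} e^{2c_a} · 2 Σ_{u ∈ D_a} e^{2c_u} K₁ e^{−K₂ dist(a,u)}`
(change the links of `A` one at a time). [cite: Chatterjee2021, Lemma 7.5] -/
theorem abs_integral_sub_le_of_strongExpDecayZd_twoVolume_of_eqOn (hρ : Continuous ρ) {C : ℝ} (hC0 : 0 ≤ C)
    (hC : ∀ (x : Site d) (i j : Fin d) (U : LGConfig d G), |plaquetteObs ρ x i j U| ≤ C)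
    {β K₁ K₂ : ℝ} (hdecay : StrongExpDecayZd d ρ β K₁ K₂) (Λ : Finset (ZdEdge d))
    (A : Finset (ZdEdge d)) (M' : ZdEdge d → ℕ) (v' : ZdEdge d → Fin d → ℤ)
    (Λ' D : ZdEdge d → Finset (ZdEdge d))
    (hΛ' : ∀ a ∈ A, Λ' a = (((Fintype.piFinset fun j : Fin d => Finset.Icc (v' a j) (v' a j + M' a)) ×ˢ
        (Finset.univ : Finset (Fin d))).filter fun e =>
          e.1 e.2 + 1 ≤ v' a e.2 + M' a ∧ ∀ j, j ≠ e.2 → v' a j < e.1 j ∧ e.1 j < v' a j + M' a))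
    (hsub : ∀ a ∈ A, Λ' a ⊆ Λ) (ha : ∀ a ∈ A, (∀ j, v' a j ≤ a.1 j ∧ a.1 j ≤ v' a j + M' a) ∧
      a.1 a.2 + 1 ≤ v' a a.2 + M' a ∧ a ∉ Λ)
    (hD : ∀ a ∈ A, ∀ u ∈ D a, (∀ j, v' a j ≤ u.1 j ∧ u.1 j ≤ v' a j + M' a) ∧ u.1 u.2 + 1 ≤ v' a u.2 + M' a ∧
      u ∉ Λ' a ∧ u ∉ (plaquettesTouching ({a} : Finset (ZdEdge d))).biUnion plaquetteEdges)
    (hread : ∀ a ∈ A, ∀ u, u ∉ Λ' a → (u ∈ (plaquettesTouching (Λ' a)).biUnion plaquetteEdges ∨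
      u ∈ (plaquettesTouching ({a} : Finset (ZdEdge d))).biUnion plaquetteEdges) → u ∈ D a ∨ u ∉ Λ)
    (η η' : LGConfig d G) (hηη' : ∀ e, e ∉ A → η e = η' e)
    {f : LGConfig d G → ℝ} (hfm : Measurable f) (hf1 : ∀ U, |f U| ≤ 1)
    (hfdep : ∀ a ∈ A, DependsOn f ((↑(Λ' a) : Set (ZdEdge d))ᶜ))
    (hfA : ∀ a ∈ A, ∀ (U : LGConfig d G) (b : G), f (Function.update U a b) = f U) :
    |(∫ U, f U ∂(ymSpecification ρ β Λ η')) - ∫ U, f U ∂(ymSpecification ρ β Λ η)| ≤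
      ∑ a ∈ A, Real.exp (2 * (|β| * (2 * C * (plaquettesTouching ({a} : Finset (ZdEdge d))).card))) *
        (2 * ∑ u ∈ D a, Real.exp (2 * (|β| * (2 * C * (plaquettesTouching ({u} : Finset (ZdEdge d))).card))) *
          (K₁ * Real.exp (-(K₂ * QuantumFieldTheory.setDistEdges {a} {u})))) := by
  classical
  have key : ∀ s : Finset (ZdEdge d), s ⊆ A →
      |(∫ U, f U ∂(ymSpecification ρ β Λ (s.piecewise η' η))) - ∫ U, f U ∂(ymSpecification ρ β Λ η)| ≤
        ∑ a ∈ s, Real.exp (2 * (|β| * (2 * C * (plaquettesTouching ({a} : Finset (ZdEdge d))).card))) *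
          (2 * ∑ u ∈ D a, Real.exp (2 * (|β| * (2 * C * (plaquettesTouching ({u} : Finset (ZdEdge d))).card))) *
            (K₁ * Real.exp (-(K₂ * QuantumFieldTheory.setDistEdges {a} {u})))) := by
    intro s
    induction s using Finset.induction_on with
    | empty =>
      intro _
      simp
    | insert a s has ih =>
      intro hs
      have haA : a ∈ A := hs (Finset.mem_insert_self a s)
      have hsA : s ⊆ A := fun x hx => hs (Finset.mem_insert_of_mem hx)
      obtain ⟨ha1, ha2, haΛ⟩ := ha a haA
      rw [Finset.sum_insert has, Finset.piecewise_insert]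
      have hstep := abs_integral_update_sub_le_of_strongExpDecayZd_twoVolume ρ hρ hC0 hC hdecay Λ
        (s.piecewise η' η) (M' a) (v' a) (Λ' a) (hΛ' a haA) (hsub a haA) a ha1 ha2 haΛ (D a) (hD a haA)
        (hread a haA) (η' a) hfm hf1 (hfdep a haA) (fun U => hfA a haA U (η' a))
      have hprev := ih hsA
      calc |(∫ U, f U ∂(ymSpecification ρ β Λ (Function.update (s.piecewise η' η) a (η' a)))) -
              ∫ U, f U ∂(ymSpecification ρ β Λ η)|
          ≤ |(∫ U, f U ∂(ymSpecification ρ β Λ (Function.update (s.piecewise η' η) a (η' a)))) -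
                ∫ U, f U ∂(ymSpecification ρ β Λ (s.piecewise η' η))| +
              |(∫ U, f U ∂(ymSpecification ρ β Λ (s.piecewise η' η))) -
                ∫ U, f U ∂(ymSpecification ρ β Λ η)| := abs_sub_le _ _ _
        _ ≤ _ := add_le_add hstep hprev
  have hpw : A.piecewise η' η = η' := by
    funext e
    by_cases he : e ∈ A
    · rw [Finset.piecewise_eq_of_mem _ _ _ he]
    · rw [Finset.piecewise_eq_of_notMem _ _ _ he, hηη' e he]
  have := key A le_rfl
  rwa [hpw] at this

end Wilson

end Literature.MathematicalPhysics.QuantumLattice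

end
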